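import Summits.MatrixMultiplication.OmegaCensus.STPPVosperTightStructure
import Summits.MatrixMultiplication.OmegaCensus.STPPVosperClash61Tools

/-!
# ω-census (abelian STPP census): a VOSPER CLASH at `ℤ₆₁` — the beating pattern {(2,3,5),(2,4,4)} has no STPP family in ℤ₆₁ (kernel)

HONEST FRAMING (pub-omega census; verbatim): lottery ticket; floor = certified bounds/negative ranges.
Census STRUCTURE (seat pub-omega-stpp-1 gen 29, 2026-08-28), family (b2).  This EXCLUDES one two-block candidate pattern (`Σ aᵢbᵢcᵢ = 30 + 32 = 62 > 61`)
at the prime order `61` before that front is computed — a leaf no counting law of record (N7–N20) decides; nothing here is progress on `ω`.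

## Statement and proof

`no_isSTPP_zmod61_235_244`: there is no STPP family (CKSU 2005 Def. 5.1, the tree's `IsSTPP`) `(Aᵢ,Bᵢ,Cᵢ)_{i<2}` in `ℤ/61ℤ` with
`(|Aᵢ|,|Bᵢ|,|Cᵢ|) = (2,3,5), (2,4,4)`.  Write `Y₁ = C₁ − B₁` (15 points), `Z₁ = C₁ − A₁` (10), `W = C₂ − A₂ − B₂` (32, the block-2 sumset).

* Step 0 (`vosper235244_structure`): the N18 chain (`STPPAlignedDoubleKneserFilter`) is TIGHT at block `(2,4,4)`: `10 + 4 + 32 + 2 + 15 = 63 = 61 + 2`,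
  so `vosper_structure_of_n18_tight_V` gives nonzero `e, e′` with `A₂ = {α, α+e}`, `Y₁` a 15-progression of step `e`, `B₂` a 4- and
  `V = W ⊔ (Y₁ − A₂)` a progression of step `e′`, `B₂ + V = H ∖ Z₁`; counting (`|H ∖ Z₁| = 51 ≤ 4 + |V| − 1`, `|Y₁ − A₂| ≤ 16`) gives `|V| = 48` and
  `Y₁ − A₂ =` the 16-progression `{y₀ − α − e + i•e}`.
* Step 1 (`blocks`): `W = ⋃_{(a,c) ∈ A₂×C₂} (c − a − B₂)` is the union of EIGHT 4-progressions of step `e′`, pairwise disjoint by the TPP of block 2.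
* Step 2 (transport, `x ↦ e′⁻¹(x − v)`): `V ↦ {0,…,47}`, the eight blocks `↦` 4-runs, `Y₁ − A₂ ↦ {t + i•j : i < 16}` with `j = e/e′`.
* Step 3 (`STPPVosperClash61Tools`): the 32-set `T =` image of `W` obeys the prefix law `4 ∣ #{y ∈ T : y < x}` at every `x ∉ T`
  (`four_dvd_card_filter_val_lt`), in particular at the sixteen points of the progression; the finite check `step3_zmod61` (one `decide` on `ℕ` over all
  `61²` pairs `(j,t)`) leaves `j = ±1`, i.e. `e = ±e′`.
* Step 4: `A₂ ∋ α, α + e`, `B₂ ∋ β, β + e′` with `e = ±e′`: the Def-5.1 word `(s′ − s) + (t′ − t) + (γ − γ) = 0` at index pattern `(2,2,2)` holds with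
  `{s,s′} = {α, α+e}`, `t = β`, `t′ = β + e′`, so the TPP of block 2 forces `t = t′`, i.e. `e′ = 0` — contradiction.

Only Def. 5.1 (through the tree's N18 chain and two literal words), Vosper's theorem (tree, Nathanson Thm 2.7) and bookkeeping in the window `{0,…,47}` are
used.  Paper version: HOME `pub-omega-stpp-1-g28/VOSPER-CLASH-235-244-Z61.md` (Step 3 there by a 61×48 table); engine cross-check (stpp-2's `sgen.c`): UNSAT,
670 852 602 nodes, 867 s.  The orientation classes `{(2,4,4),(3,2,5)}` and `{(2,4,4),(5,2,3)}` are different patterns and are NOT treated here.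

References: A. G. Vosper, J. London Math. Soc. 31 (1956); M. B. Nathanson, *Additive Number Theory: Inverse Problems*, GTM 165, Thm 2.7; H. Cohn,
R. Kleinberg, B. Szegedy, C. Umans, FOCS 2005 (arXiv:math/0511460), Def. 5.1.
-/

open Finset
open scoped Pointwise

namespace Summit.MatrixMultiplication.OmegaCensus.CubeNB

open Literature.Computability.AlgebraicComplexity
open Literature.Combinatorics.Additive
open Summit.MatrixMultiplication.OmegaCensus.STPPKneser

/-- **Step 0 + counting.**  For an STPP family of pattern `{(2,3,5),(2,4,4)}` in `ℤ₆₁`: nonzero `e, e′` and `α, β, y₀, v` with `A₂ = {α, α+e}`,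
`B₂ = {β + i•e′ : i < 4}`, the block-2 sumset `W = {c − a − b}` and the 16-progression `{y₀ − α − e + i•e : i < 16} = Y₁ − A₂` disjoint with union the
48-progression `{v + i•e′ : i < 48}`. [cite: CohnKleinbergSzegedyUmans2005, Def. 5.1] [cite: Nathanson1996, Thm 2.7] -/
theorem vosper235244_structure (A B C : Fin 2 → Finset (ZMod 61)) (hS : IsSTPP A B C)
    (hA : ∀ i, #(A i) = ![2, 2] i) (hB : ∀ i, #(B i) = ![3, 4] i) (hC : ∀ i, #(C i) = ![5, 4] i) :
    ∃ e e' α β y₀ v : ZMod 61, e ≠ 0 ∧ e' ≠ 0 ∧ A 1 = apFinset α e 2 ∧ B 1 = apFinset β e' 4 ∧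
      Disjoint (((A 1) ×ˢ ((B 1) ×ˢ (C 1))).image fun q : ZMod 61 × ZMod 61 × ZMod 61 => (0 : ZMod 61) + q.2.2 - q.1 - q.2.1)
        (apFinset (0 - α - 1 • e + y₀) e 16) ∧
      (((A 1) ×ˢ ((B 1) ×ˢ (C 1))).image fun q : ZMod 61 × ZMod 61 × ZMod 61 => (0 : ZMod 61) + q.2.2 - q.1 - q.2.1) ∪
        apFinset (0 - α - 1 • e + y₀) e 16 = apFinset v e' 48 := by
  haveI : Fact (Nat.Prime 61) := ⟨prime_61⟩
  have hAne : ∀ i, (A i).Nonempty := fun i => card_pos.1 (by rw [hA]; fin_cases i <;> simp)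
  have hBne : ∀ i, (B i).Nonempty := fun i => card_pos.1 (by rw [hB]; fin_cases i <;> simp)
  have hCne : ∀ i, (C i).Nonempty := fun i => card_pos.1 (by rw [hC]; fin_cases i <;> simp)
  have e1 : (univ : Finset (Fin 2)).erase 1 = {0} := by decide
  have hI1 : ((univ : Finset (Fin 2)).erase 1).Nonempty := ⟨0, by decide⟩
  have sAC : ∑ k ∈ (univ : Finset (Fin 2)).erase 1, #(A k) * #(C k) = 10 := by rw [e1, Finset.sum_singleton, hA, hC]; simp
  have sBC : ∑ k ∈ (univ : Finset (Fin 2)).erase 1, #(B k) * #(C k) = 15 := by rw [e1, Finset.sum_singleton, hB, hC]; simp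
  have hA1 : #(A 1) = 2 := by rw [hA]; simp
  have hB1 : #(B 1) = 4 := by rw [hB]; simp
  have hC1 : #(C 1) = 4 := by rw [hC]; simp
  obtain ⟨⟨e, he, hAap, hYap⟩, ⟨e', he', hBap, -, hVap, -, hEq⟩⟩ := vosper_structure_of_n18_tight_V hS hAne hBne hCne 1 hI1
    (by rw [hA1]) (by rw [hB1]; omega) (by rw [sBC]; omega) (by rw [sAC]; omega) (by rw [sAC, sBC, hA1, hB1, hC1])
  -- names
  set W := ((A 1) ×ˢ ((B 1) ×ˢ (C 1))).image fun q : ZMod 61 × ZMod 61 × ZMod 61 => (0 : ZMod 61) + q.2.2 - q.1 - q.2.1 with hW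
  set Sn := (A 1).image (fun a => (0 : ZMod 61) - a) with hSn
  set Yo := DU B C (univ.erase 1) with hYo
  have hWcard : #W = 32 := by rw [hW, card_image_blockSum hS 1 0, hA1, hB1, hC1]
  have hWV : Disjoint W (Sn + Yo) := disjoint_W_negA_add_DU hS 1
  have hYocard : #Yo = 15 := by rw [hYo, card_DU_BC hS hAne, sBC]
  -- the progressions
  obtain ⟨α, hα⟩ := hAap
  obtain ⟨β, hβ⟩ := hBap
  obtain ⟨y₀, hy⟩ := hYap
  obtain ⟨v, hv⟩ := hVap
  rw [hA1] at hα; rw [hB1] at hβ; rw [hYocard] at hy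
  -- Sn + Yo lies in a 16-progression of step e
  have hSn2 : Sn = apFinset (0 - α - 1 • e) e 2 := by rw [hSn, hα, image_sub_apFinset]
  have hsub16 : Sn + Yo ⊆ apFinset (0 - α - 1 • e + y₀) e 16 := by
    rw [hSn2, hy]; exact apFinset_add_apFinset_subset _ _ _ 2 15
  have hle16 : #(Sn + Yo) ≤ 16 := (Finset.card_le_card hsub16).trans (card_apFinset_le _ _ _)
  -- |V| ≥ 48 from B₂ + V = H ∖ Z₁ (51 elements)
  have hZcard : #(DU A C (univ.erase 1)) = 10 := by rw [card_DU_AC hS hBne, sAC]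
  have hU : #(univ \ DU A C ((univ : Finset (Fin 2)).erase 1)) = 51 := by
    rw [Finset.card_sdiff_of_subset (Finset.subset_univ _), Finset.card_univ, ZMod.card, hZcard]
  have hBV : #(B 1 + (W ∪ (Sn + Yo))) ≤ 4 + #(W ∪ (Sn + Yo)) - 1 := by
    have h := (Finset.card_le_card (apFinset_add_apFinset_subset β v e' 4 #(W ∪ (Sn + Yo)))).trans (card_apFinset_le _ _ _)
    rwa [← hβ, ← hv] at h
  rw [hEq, hU] at hBV
  have hVcard : #(W ∪ (Sn + Yo)) = #W + #(Sn + Yo) := Finset.card_union_of_disjoint hWV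
  have h16 : #(Sn + Yo) = 16 := by omega
  have hV48 : #(W ∪ (Sn + Yo)) = 48 := by omega
  have hSY : Sn + Yo = apFinset (0 - α - 1 • e + y₀) e 16 :=
    Finset.eq_of_subset_of_card_le hsub16 (by rw [h16, card_apFinset he (by norm_num)])
  rw [hV48] at hv
  refine ⟨e, e', α, β, y₀, v, he, he', hα, hβ, ?_, ?_⟩
  · rw [← hSY]; exact hWV
  · rw [← hSY]; exact hv

/-- **VOSPER CLASH (kernel): the beating pattern `{(2,3,5),(2,4,4)}` (`Σ abc = 62 > 61`) is realised by NO STPP family in `ℤ₆₁`.**  See the module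
docstring: N18-tightness at block `(2,4,4)` and Vosper make `B₂`, `W = C₂ − A₂ − B₂` (eight disjoint 4-progressions) and `W ⊔ (Y₁ − A₂)` progressions of
step `e′`, and `Y₁ − A₂` a 16-progression of step `e`; after transport to `{0,…,47}` the prefix law of the eight 4-runs and the finite check
`step3_zmod61` force `e = ±e′`, and then the word `(s′ − s) + (t′ − t) + (γ − γ) = 0` at `(2,2,2)` breaks the TPP of block 2.  HOME
`pub-omega-stpp-1-g28/VOSPER-CLASH-235-244-Z61.md` (paper); engine cross-check sgen UNSAT 670 852 602 nodes.
[cite: CohnKleinbergSzegedyUmans2005, Def. 5.1] [cite: Nathanson1996, Thm 2.7] -/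
theorem no_isSTPP_zmod61_235_244 (A B C : Fin 2 → Finset (ZMod 61)) (hS : IsSTPP A B C)
    (hA : ∀ i, #(A i) = ![2, 2] i) (hB : ∀ i, #(B i) = ![3, 4] i) (hC : ∀ i, #(C i) = ![5, 4] i) : False := by
  haveI : Fact (Nat.Prime 61) := ⟨prime_61⟩
  obtain ⟨e, e', α, β, y₀, v, he, he', hα, hβ, hdisj, hunion⟩ := vosper235244_structure A B C hS hA hB hC
  set W := ((A 1) ×ˢ ((B 1) ×ˢ (C 1))).image fun q : ZMod 61 × ZMod 61 × ZMod 61 => (0 : ZMod 61) + q.2.2 - q.1 - q.2.1 with hW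
  -- Step 1: W is the union of the eight blocks (c − a) − B₂, pairwise disjoint by the TPP of block 2
  set P := (A 1) ×ˢ (C 1) with hP
  have hblk : ∀ ac : ZMod 61 × ZMod 61, (B 1).image (fun y => (ac.2 - ac.1) - y) = apFinset (ac.2 - ac.1 - β - 3 • e') e' 4 := by
    intro ac; rw [hβ, image_sub_apFinset]
  have hWeq : W = P.biUnion fun ac => apFinset (ac.2 - ac.1 - β - 3 • e') e' 4 := by
    ext x
    simp only [hW, hP, Finset.mem_image, Finset.mem_product, Finset.mem_biUnion, Prod.exists]
    constructor
    · rintro ⟨a, b, c, ⟨ha, hb, hc⟩, rfl⟩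
      refine ⟨a, c, ⟨ha, hc⟩, ?_⟩
      rw [← hblk (a, c)]
      exact Finset.mem_image.2 ⟨b, hb, by abel⟩
    · rintro ⟨a, c, ⟨ha, hc⟩, hx⟩
      rw [← hblk (a, c)] at hx
      obtain ⟨b, hb, rfl⟩ := Finset.mem_image.1 hx
      exact ⟨a, b, c, ⟨ha, hb, hc⟩, by abel⟩
  have hPdisj : (P : Set (ZMod 61 × ZMod 61)).PairwiseDisjoint fun ac => apFinset (ac.2 - ac.1 - β - 3 • e') e' 4 := by
    rintro ⟨a, c⟩ hac ⟨a', c'⟩ hac' hne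
    rw [Function.onFun, ← hblk, ← hblk, Finset.disjoint_left]
    intro x hx hx'
    obtain ⟨b, hb, rfl⟩ := Finset.mem_image.1 hx
    obtain ⟨b', hb', hbb⟩ := Finset.mem_image.1 hx'
    have hac2 := Finset.mem_product.1 (Finset.mem_coe.1 hac)
    have hac2' := Finset.mem_product.1 (Finset.mem_coe.1 hac')
    -- word at (2,2,2): (a′ − a) + (b′ − b) + (c − c′) = 0
    have hrel : (a' - a) + (b' - b) + (c - c') = 0 := by
      have h : c' - a' - b' = c - a - b := hbb
      linear_combination (-1 : ZMod 61) * h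
    obtain ⟨-, -, h3, -, h5⟩ := hS 1 1 1 a hac2.1 a' hac2'.1 b hb b' hb' c' hac2'.2 c hac2.2 hrel
    exact hne (Prod.ext h3 h5.symm)
  -- Step 2: transport by φ(x) = u·x + w, u = e′⁻¹, w = −u·v
  obtain ⟨u, hu⟩ : ∃ u : ZMod 61, u = e'⁻¹ := ⟨_, rfl⟩
  have hu0 : u ≠ 0 := by rw [hu]; exact inv_ne_zero he'
  have hue : u * e' = 1 := by rw [hu]; exact inv_mul_cancel₀ he'
  obtain ⟨w, hw⟩ : ∃ w : ZMod 61, w = -(u * v) := ⟨_, rfl⟩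
  have hφinj : Function.Injective (fun x : ZMod 61 => u * x + w) := affine_injective hu0 w
  have hφV : (apFinset v e' 48).image (fun x => u * x + w) = apFinset 0 1 48 := by
    rw [image_affine_apFinset, hue, hw, add_neg_cancel]
  set g : ZMod 61 × ZMod 61 → ZMod 61 := fun ac => u * (ac.2 - ac.1 - β - 3 • e') + w with hg
  have hφblk : ∀ ac : ZMod 61 × ZMod 61,
      (apFinset (ac.2 - ac.1 - β - 3 • e') e' 4).image (fun x => u * x + w) = apFinset (g ac) 1 4 := by
    intro ac; rw [image_affine_apFinset, hue]
  set T := W.image (fun x => u * x + w) with hT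
  have hTeq : T = P.biUnion fun ac => apFinset (g ac) 1 4 := by
    rw [hT, hWeq, Finset.biUnion_image]
    exact Finset.biUnion_congr rfl fun ac _ => hφblk ac
  have hTdisj : (P : Set (ZMod 61 × ZMod 61)).PairwiseDisjoint fun ac => apFinset (g ac) 1 4 := by
    intro ac hac ac' hac' hne
    rw [Function.onFun, ← hφblk, ← hφblk]
    exact (Finset.disjoint_image hφinj).2 (hPdisj hac hac' hne)
  set S := (apFinset (0 - α - 1 • e + y₀) e 16).image (fun x => u * x + w) with hSdef
  have hSeq : S = apFinset (u * (0 - α - 1 • e + y₀) + w) (u * e) 16 := by rw [hSdef, image_affine_apFinset]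
  have hTS : T ∪ S = apFinset 0 1 48 := by rw [hT, hSdef, ← Finset.image_union, hunion, hφV]
  have hTSdisj : Disjoint T S := by rw [hT, hSdef]; exact (Finset.disjoint_image hφinj).2 hdisj
  have hTsub : ∀ ac ∈ P, apFinset (g ac) 1 4 ⊆ apFinset 0 1 48 := by
    intro ac hac y hy
    rw [← hTS, hTeq]
    exact Finset.mem_union_left _ (Finset.mem_biUnion.2 ⟨ac, hac, hy⟩)
  have hSsub : S ⊆ apFinset 0 1 48 := by rw [← hTS]; exact Finset.subset_union_right
  -- Step 3: the prefix law at the gap points, and the finite check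
  have hj0 : u * e ≠ 0 := mul_ne_zero hu0 he
  have hgap : ∀ x ∈ S, 4 ∣ x.val - #(S.filter fun y => y.val < x.val) := by
    intro x hxS
    have hxT : x ∉ T := fun hxT => Finset.disjoint_left.1 hTSdisj hxT hxS
    have hxle : x.val ≤ 48 := ((mem_apFinset_zero_one_iff (p := 61) (by norm_num)).1 (hSsub hxS)).le
    have h4 : 4 ∣ #(T.filter fun y => y.val < x.val) := by
      rw [hTeq]
      exact four_dvd_card_filter_val_lt P g hTdisj hTsub x (by rw [← hTeq]; exact hxT)
    rw [(card_filter_val_lt_of_union hTS hTSdisj hxle).2] at h4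
    exact h4
  rw [hSeq] at hgap hSsub
  have hpm : u * e = 1 ∨ u * e = -1 := step3_zmod61 hj0 hSsub hgap
  have hpm' : e = e' ∨ e = -e' := by
    have hee : e' * (u * e) = e := by rw [← mul_assoc, mul_comm e' u, hue, one_mul]
    rcases hpm with h | h
    · left; rw [← hee, h, mul_one]
    · right; rw [← hee, h, mul_neg, mul_one]
  -- Step 4: the TPP of block 2 fails
  have hCne : (C 1).Nonempty := card_pos.1 (by rw [hC]; simp)
  obtain ⟨γ, hγ⟩ := hCne
  have hαmem : α ∈ A 1 := by rw [hα]; exact mem_apFinset.2 ⟨0, by norm_num, by simp⟩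
  have hαe : α + e ∈ A 1 := by rw [hα]; exact mem_apFinset.2 ⟨1, by norm_num, by simp⟩
  have hβmem : β ∈ B 1 := by rw [hβ]; exact mem_apFinset.2 ⟨0, by norm_num, by simp⟩
  have hβe : β + e' ∈ B 1 := by rw [hβ]; exact mem_apFinset.2 ⟨1, by norm_num, by simp⟩
  rcases hpm' with h | h
  · -- e = e′: s = α + e, s′ = α, t = β, t′ = β + e′
    have hrel : (α - (α + e)) + ((β + e') - β) + (γ - γ) = 0 := by rw [h]; ring
    obtain ⟨-, -, -, h4, -⟩ := hS 1 1 1 (α + e) hαe α hαmem β hβmem (β + e') hβe γ hγ γ hγ hrel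
    exact he' (by linear_combination h4.symm)
  · -- e = −e′: s = α, s′ = α + e
    have hrel : ((α + e) - α) + ((β + e') - β) + (γ - γ) = 0 := by rw [h]; ring
    obtain ⟨-, -, -, h4, -⟩ := hS 1 1 1 α hαmem (α + e) hαe β hβmem (β + e') hβe γ hγ γ hγ hrel
    exact he' (by linear_combination h4.symm)

end Summit.MatrixMultiplication.OmegaCensus.CubeNB
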